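import Summits.ResolutionOfSingularities.ResolutionOfSingularities.Theorems.LossEntryW21
import HarnessLib

/-!
# LossEntryW22 (= lens-3 g29 slice 14) — walk plumbing of the loss→entry law — section-shear invariance; (S4) the ceiling-chart β-step in general

decomp-res-lens-3, gen 29 (NODE-g29 §3ter).  TOOL at 0.  Imports `Theorems.LossEntryW21`.

§34 — THE SECTION SHEAR DOES NOT MOVE THE VERTEX, AND (S4) IN GENERAL (NODE-g29 §3ter (S4)): `toLex_resPoint_le_of_section_partner` (same-frame
partner comparison, axis allowed through the degree bound), **`vertexOf_polyPts_shear_section`** (for a CLEAN `X` with the wall `r a ≤ D a` and degrees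
`≥ r a + s`, and ANY `β`: the frame-`(a;b,c)` polygon of `clean(σ_{b,c,β} X)` has the same lex-min vertex as that of `X` — two-sided domination by
`exists_dom_of_mem_support_shear` / `exists_dom_shear_of_mem_support`), and **`betaOf_polyPts_succ_ceiling_le`**: THE CEILING-CHART β-STEP FROM A STRAIGHT
ONE-WALL STATE DOES NOT RAISE THE ORDINATE, for ANY `b_v(b)` — with `X := σ_{b,c,b_v(b)} F_v`: target polygon `= entryPts s (M+s) b a (clean σ_{a,c,g_a} X)`
(`st_succ_F_two_shears`, `polyPts_deletePthPowers_chartTransform_eq_entryPts`) `=` (reading independence, `swapShear_shear`) the entry set of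
`clean σ_{c,a,g_a⁻¹} X` `=` the frame-`(a;b,c)` polygon of the α-step applied to `clean X` (`alphaStep_deletePthPowers`, `shear_zero`) `≤` (pure α-law)
`ŷ(polyPts (a;b,c) (clean X))` `=` (section-shear invariance) `ŷ(P_v)`.  Hypotheses: walk facts + both wall polygons non-empty + `x̂_v < 1`; no layer,
no legality of a fictitious state.  With §30/§31 ((S1) α, (S2) β-section) and §32/§35 ((S3) frames) ALL FOUR STEP TYPES of NODE-g29 §3ter are now
kernel-checked step laws.
-/

open MvPolynomial Finset
open Literature.AlgebraicGeometry.Resolution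
open Literature.AlgebraicGeometry.Resolution.Hauser2010
open Literature.AlgebraicGeometry.Resolution.PointBlowup
open Summit.ResolutionOfSingularities.ResolutionOfSingularities.Theorems.TightDefectClasses
open Summit.ResolutionOfSingularities.ResolutionOfSingularities.Theorems.TightDefectStrongWalks
open Summit.ResolutionOfSingularities.ResolutionOfSingularities.Theorems.ItineraryCutClasses
open Summit.ResolutionOfSingularities.ResolutionOfSingularities.Theorems.BoundaryLedger
open Summit.ResolutionOfSingularities.ResolutionOfSingularities.Theorems.ProximityCut
open Summit.ResolutionOfSingularities.ResolutionOfSingularities.Theorems.LossExitCone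
open Summit.ResolutionOfSingularities.ResolutionOfSingularities.Theorems.LossPolygon

/-! ## §34 THE SECTION SHEAR `σ_{b,c,β}` DOES NOT MOVE THE VERTEX, AND THE CEILING-CHART β-STEP IN GENERAL (NODE-g29 §3ter (S4)) -/

namespace Summit.ResolutionOfSingularities.ResolutionOfSingularities.Theorems.LossPolygon

variable {K : Type} [Field K] {q : ℕ}

section SectionShear

variable {a b c : Fin 3}

/-- Same-frame partner comparison for the section shear: equal `a`-exponent and degree, no larger ceiling exponent `D c ≤ E c < s`
⇒ the point of `D` is lexicographically below the point of `E` — off the axis the abscissa decides; ON the axis (`D a = r a`) the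
degree bound `r a + s ≤ |D|` gives `E b + E c ≥ s`, which is exactly what the ordinate comparison needs. [new; elementary] -/
theorem toLex_resPoint_le_of_section_partner (hab : a ≠ b) (hac : a ≠ c) (hbc : b ≠ c) {s : ℕ} {r : Fin 3 →₀ ℕ}
    (hrb : r b = 0) (hrc : r c = 0) {D E : Fin 3 →₀ ℕ} (hDa : D a = E a) (hdeg : D.degree = E.degree) (hc : D c ≤ E c)
    (hEc : E c < s) (hwall : r a ≤ D a) (hdegD : r a + s ≤ D.degree) :
    toLex (resPoint s r a b c D) ≤ toLex (resPoint s r a b c E) := by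
  have h1 := degree_fin3 hab hac hbc D
  have h2 := degree_fin3 hab hac hbc E
  have hDb : D b + D c = E b + E c := by omega
  have hxD : (resPoint s r a b c D).1 = ((((D a : ℕ) : ℚ)) - r a) / (((s : ℕ) : ℚ) - D c) := by
    show ((((D a : ℕ) : ℚ)) - r a) / (((s : ℕ) : ℚ) + r c - D c) = _
    rw [hrc, Nat.cast_zero, add_zero]
  have hyD : (resPoint s r a b c D).2 = (((D b : ℕ) : ℚ)) / (((s : ℕ) : ℚ) - D c) := by
    show ((((D b : ℕ) : ℚ)) - r b) / (((s : ℕ) : ℚ) + r c - D c) = _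
    rw [hrb, hrc, Nat.cast_zero, add_zero, sub_zero]
  have hxE : (resPoint s r a b c E).1 = ((((E a : ℕ) : ℚ)) - r a) / (((s : ℕ) : ℚ) - E c) := by
    show ((((E a : ℕ) : ℚ)) - r a) / (((s : ℕ) : ℚ) + r c - E c) = _
    rw [hrc, Nat.cast_zero, add_zero]
  have hyE : (resPoint s r a b c E).2 = (((E b : ℕ) : ℚ)) / (((s : ℕ) : ℚ) - E c) := by
    show ((((E b : ℕ) : ℚ)) - r b) / (((s : ℕ) : ℚ) + r c - E c) = _
    rw [hrb, hrc, Nat.cast_zero, add_zero, sub_zero]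
  have hdE : (0 : ℚ) < ((s : ℕ) : ℚ) - E c := by
    have : ((E c : ℕ) : ℚ) < s := by exact_mod_cast hEc
    linarith
  have hcd : ((D c : ℕ) : ℚ) ≤ E c := by exact_mod_cast hc
  have hdD : (0 : ℚ) < ((s : ℕ) : ℚ) - D c := by linarith
  rw [toLex_le_toLex_iff, hxD, hyD, hxE, hyE]
  rcases Nat.eq_or_lt_of_le hwall with hax | hpos
  · -- on the axis: equal abscissa `0`, ordinates compare through `E b + E c ≥ s`
    right
    refine ⟨by rw [hax, hDa, sub_self, zero_div, zero_div], ?_⟩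
    have hs' : s ≤ E b + E c := by omega
    have hbs : ((s : ℕ) : ℚ) ≤ ((E b : ℕ) : ℚ) + E c := by exact_mod_cast hs'
    have hsum : ((D b : ℕ) : ℚ) + D c = ((E b : ℕ) : ℚ) + E c := by exact_mod_cast hDb
    have hDbq : ((D b : ℕ) : ℚ) = ((E b : ℕ) : ℚ) + E c - D c := by linarith
    rw [div_le_div_iff₀ hdD hdE, hDbq]
    nlinarith [mul_nonneg (sub_nonneg.mpr hcd) (by linarith : (0 : ℚ) ≤ ((E b : ℕ) : ℚ) + E c - s)]
  · rcases Nat.eq_or_lt_of_le hc with hcc | hcc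
    · -- same ceiling exponent: the same point
      right
      have hbb : D b = E b := by omega
      rw [hDa, hcc, hbb]
      exact ⟨rfl, le_rfl⟩
    · -- strictly smaller ceiling exponent, positive numerator: strictly smaller abscissa
      left
      have hN : (0 : ℚ) < (((E a : ℕ) : ℚ)) - r a := by
        have : ((r a : ℕ) : ℚ) < D a := by exact_mod_cast hpos
        rw [hDa] at this; linarith
      have hdd : ((s : ℕ) : ℚ) - E c < ((s : ℕ) : ℚ) - D c := by
        have : ((D c : ℕ) : ℚ) < E c := by exact_mod_cast hcc
        linarith
      rw [hDa]
      exact div_lt_div_of_pos_left hN hdE hdd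

/-- **THE SECTION SHEAR DOES NOT MOVE THE VERTEX (PROVED; NODE-g29 §3ter (S4)).**  For a CLEAN `X` with the wall `r a ≤ D a` and all
degrees `≥ r a + s`, and ANY `β`: the one-wall polygon of `clean (σ_{b,c,β} X)` (`u_b ↦ u_b + β u_c`, section letter into the ceiling letter)
in the frame `(a ; b, c)` is non-empty and has THE SAME LEX-MIN VERTEX as that of `X` — two-sided domination along the lines
`(E a, |E|)` by `exists_dom_of_mem_support_shear` / `exists_dom_shear_of_mem_support` (W04) and the partner comparison above.  Companion of
(R2) `vertexOf_polyPts_shear_wall` (ceiling into WALL letter). [new] -/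
theorem vertexOf_polyPts_shear_section (hab : a ≠ b) (hac : a ≠ c) (hbc : b ≠ c)
    (hLucas : ∀ D T : ℕ, q ∣ D → ¬ q ∣ T → ((D.choose T : ℕ) : K) = 0) {s : ℕ} {r : Fin 3 →₀ ℕ}
    (hrb : r b = 0) (hrc : r c = 0) (β : K) {X : MvPolynomial (Fin 3) K}
    (hclean : ∀ D ∈ X.support, ¬ IsPthPowerExponent q D) (hwall : ∀ D ∈ X.support, r a ≤ D a)
    (hdeg : ∀ D ∈ X.support, r a + s ≤ D.degree) (hne : (polyPts s r a b c X).Nonempty) :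
    (polyPts s r a b c (deletePthPowers q (shear b c β X))).Nonempty ∧
      vertexOf (polyPts s r a b c (deletePthPowers q (shear b c β X))) = vertexOf (polyPts s r a b c X) := by
  classical
  have hXc : (deletePthPowers q X).support = X.support := by
    rw [support_deletePthPowers']; exact Finset.filter_true_of_mem hclean
  have hA : ∀ x ∈ polyPts s r a b c (deletePthPowers q (shear b c β X)), ∃ y ∈ polyPts s r a b c X, toLex y ≤ toLex x := by
    intro x hx
    obtain ⟨E', hE', rfl⟩ := Finset.mem_image.mp hx
    obtain ⟨hE'S, hE'c⟩ := Finset.mem_filter.mp hE'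
    have hE'c' : E' c < s := by rw [hrc, add_zero] at hE'c; exact hE'c
    obtain ⟨D, hD, hDa, hDdeg, hDor⟩ := exists_dom_of_mem_support_shear (Ne.symm hac) (Ne.symm hbc) hab hLucas β X hE'S
    rw [hXc] at hD
    have hDc : D c ≤ E' c := by
      rcases hDor with rfl | h
      · exact le_rfl
      · exact h.le
    refine ⟨resPoint s r a b c D, Finset.mem_image_of_mem _
      (Finset.mem_filter.mpr ⟨hD, by rw [hrc, add_zero]; exact lt_of_le_of_lt hDc hE'c'⟩), ?_⟩
    exact toLex_resPoint_le_of_section_partner hab hac hbc hrb hrc hDa hDdeg hDc hE'c' (hwall D hD) (hdeg D hD)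
  have hB : ∀ y ∈ polyPts s r a b c X, ∃ x ∈ polyPts s r a b c (deletePthPowers q (shear b c β X)), toLex x ≤ toLex y := by
    intro y hy
    obtain ⟨E, hE, rfl⟩ := Finset.mem_image.mp hy
    obtain ⟨hES, hEc⟩ := Finset.mem_filter.mp hE
    have hEc' : E c < s := by rw [hrc, add_zero] at hEc; exact hEc
    have hEX : E ∈ (deletePthPowers q X).support := by rw [hXc]; exact hES
    obtain ⟨E', hE', hE'a, hE'deg, hE'or⟩ := exists_dom_shear_of_mem_support (Ne.symm hac) (Ne.symm hbc) hab hLucas β X hEX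
    have hE'c : E' c ≤ E c := by
      rcases hE'or with rfl | h
      · exact le_rfl
      · exact h.le
    refine ⟨resPoint s r a b c E', Finset.mem_image_of_mem _
      (Finset.mem_filter.mpr ⟨hE', by rw [hrc, add_zero]; exact lt_of_le_of_lt hE'c hEc'⟩), ?_⟩
    exact toLex_resPoint_le_of_section_partner hab hac hbc hrb hrc hE'a hE'deg hE'c hEc'
      (by rw [hE'a]; exact hwall E hES) (by rw [hE'deg]; exact hdeg E hES)
  obtain ⟨y, hy⟩ := hne
  obtain ⟨x, hx, -⟩ := hB y hy
  exact ⟨⟨x, hx⟩, vertexOf_eq_of_dom ⟨x, hx⟩ ⟨y, hy⟩ hA hB⟩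

end SectionShear

section CeilingStepWalkGeneral

variable [DecidableEq K] {s₀ : State (Fin 3) K}

/-- **(S4) — THE CEILING-CHART β-STEP DOES NOT RAISE THE ORDINATE (PROVED; NODE-g29 §3ter (S4), general `b_v(b)`).**
At a straight one-wall state `v` (`r_v = M e_a`, all degrees `≥ M + s`, frame `(a ; b, c)`, polygon non-empty with `x̂ < 1`) whose move is in the
chart of the CEILING letter `c` with `b_v(a) ≠ 0`, leaving the one-wall state `r_{v+1} = M′ e_c`, `q + M′ = M + s` with non-empty polygon:
`ŷ(polyPts s r_{v+1} c b a F_{v+1}) ≤ ŷ(polyPts s r_v a b c F_v)` (new frame `(c ; b, a)`).  Proof = READING INDEPENDENCE + the PURE α-LAW on the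
section-sheared source: with `X := σ_{b,c,b_v(b)} F_v`, `F_{v+1} = clean(chart_c(σ_{a,c,g_a} X))` (`st_succ_F_two_shears`), its polygon is
`entryPts s (M+s) b a (clean(σ_{a,c,g_a} X))`, `swapShear a c g_a g_a⁻¹ (σ_{a,c,g_a} X) = σ_{c,a,g_a⁻¹} X` (`swapShear_shear`) has the same entry vertex
(`vertexOf_entryPts_swapShear`, fixed letter `b`), its entry set is the frame-`(a;b,c)` polygon of `clean(chart_a(σ_{c,a,g_a⁻¹} X))` = (clean inside,
`alphaStep_deletePthPowers`) that of the α-step applied to `clean X`, whose ordinate the pure α-law `betaOf_polyPts_alphaStep_le` bounds by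
`ŷ(polyPts (a;b,c) (clean X))` — and `clean X = clean(σ_{b,c,β} F_v)` has the same vertex as `F_v` (`vertexOf_polyPts_shear_section`).  No layer /
legality hypothesis on the new state is used. [new] -/
theorem betaOf_polyPts_succ_ceiling_le (hs : IsRoot q s₀) (W : ForcedWalk q s₀) (v : ℕ) {a b c : Fin 3}
    (hab : a ≠ b) (hac : a ≠ c) (hbc : b ≠ c) (hj : W.j v = c)
    (hLucas : ∀ D T : ℕ, q ∣ D → ¬ q ∣ T → ((D.choose T : ℕ) : K) = 0) {s M M' : ℕ} (hoM : q + M' = M + s)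
    (hord : ∀ D ∈ (W.st v).F.support, M + s ≤ D.degree)
    (hrva : (W.st v).r a = M) (hrvb : (W.st v).r b = 0) (hrvc : (W.st v).r c = 0)
    (hr₁c : (W.st (v + 1)).r c = M') (hr₁a : (W.st (v + 1)).r a = 0) (hr₁b : (W.st (v + 1)).r b = 0)
    (hga : W.b v a ≠ 0)
    (hne : (polyPts s (W.st v).r a b c (W.st v).F).Nonempty) (hα : alphaOf (polyPts s (W.st v).r a b c (W.st v).F) < 1)
    (hne₁ : (polyPts s (W.st (v + 1)).r c b a (W.st (v + 1)).F).Nonempty) :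
    betaOf (polyPts s (W.st (v + 1)).r c b a (W.st (v + 1)).F) ≤ betaOf (polyPts s (W.st v).r a b c (W.st v).F) := by
  classical
  have hνg : W.b v a * (W.b v a)⁻¹ = 1 := mul_inv_cancel₀ hga
  have hgi : (W.b v a)⁻¹ ≠ 0 := inv_ne_zero hga
  -- the move, on the section-sheared source `X = σ_{b,c,b_v(b)} F_v`
  have hF : (W.st (v + 1)).F =
      deletePthPowers q (chartTransform q c (shear a c (W.b v a) (shear b c (W.b v b) (W.st v).F))) :=
    st_succ_F_two_shears hs W v hac hbc hab hj
  -- degrees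
  have hdegX : ∀ E ∈ (shear b c (W.b v b) (W.st v).F).support, M + s ≤ E.degree := fun E hE => by
    obtain ⟨D₀, hD₀, hdeg⟩ := exists_degree_eq_of_mem_support_shear b c (W.b v b) _ hE
    rw [hdeg]; exact hord D₀ hD₀
  have hordS : ∀ E ∈ (shear a c (W.b v a) (shear b c (W.b v b) (W.st v).F)).support, M + s ≤ E.degree := fun E hE => by
    obtain ⟨D₀, hD₀, hdeg⟩ := exists_degree_eq_of_mem_support_shear a c (W.b v a) _ hE
    rw [hdeg]; exact hdegX D₀ hD₀
  have hordY : ∀ E ∈ (shear c a (W.b v a)⁻¹ (shear b c (W.b v b) (W.st v).F)).support, M + s ≤ E.degree := fun E hE => by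
    obtain ⟨D₀, hD₀, hdeg⟩ := exists_degree_eq_of_mem_support_shear c a (W.b v a)⁻¹ _ hE
    rw [hdeg]; exact hdegX D₀ hD₀
  have ho' : ∀ E ∈ (deletePthPowers q (shear a c (W.b v a) (shear b c (W.b v b) (W.st v).F))).support, M + s ≤ E.degree :=
    fun E hE => by rw [support_deletePthPowers', Finset.mem_filter] at hE; exact hordS E hE.1
  -- the target polygon is an entry set
  have hT : polyPts s (W.st (v + 1)).r c b a (W.st (v + 1)).F =
      entryPts s (M + s) b a (deletePthPowers q (shear a c (W.b v a) (shear b c (W.b v b) (W.st v).F))) := by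
    rw [hF]; exact polyPts_deletePthPowers_chartTransform_eq_entryPts hbc (Ne.symm hac) hoM hr₁c hr₁b hr₁a hordS
  -- the fictitious α-reading
  have hY : swapShear a c (W.b v a) (W.b v a)⁻¹ (shear a c (W.b v a) (shear b c (W.b v b) (W.st v).F)) =
      shear c a (W.b v a)⁻¹ (shear b c (W.b v b) (W.st v).F) := swapShear_shear hac hνg _
  set r' : Fin 3 →₀ ℕ := Finsupp.single a M' with hr'
  have hr'a : r' a = M' := by rw [hr', Finsupp.single_apply, if_pos rfl]
  have hr'b : r' b = 0 := by rw [hr', Finsupp.single_apply, if_neg hab]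
  have hr'c : r' c = 0 := by rw [hr', Finsupp.single_apply, if_neg hac]
  have hA : polyPts s r' a b c (deletePthPowers q (chartTransform q a (shear c a (W.b v a)⁻¹ (shear b c (W.b v b) (W.st v).F)))) =
      entryPts s (M + s) b c (deletePthPowers q (shear c a (W.b v a)⁻¹ (shear b c (W.b v b) (W.st v).F))) :=
    polyPts_deletePthPowers_chartTransform_eq_entryPts hab.symm hac hoM hr'a hr'b hr'c hordY
  -- reading independence
  have hneT : (entryPts s (M + s) b a (deletePthPowers q (shear a c (W.b v a) (shear b c (W.b v b) (W.st v).F)))).Nonempty := by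
    rw [← hT]; exact hne₁
  have hRI := (vertexOf_entryPts_swapShear hab hac hbc hga hgi hνg hLucas (s := s) (o := M + s) _ ho' hneT).2
  rw [hY] at hRI
  -- the section shear at the source does not move the vertex
  have hsec := vertexOf_polyPts_shear_section hab hac hbc hLucas hrvb hrvc (W.b v b) (X := (W.st v).F)
    (fun D hD => not_isPthPowerExponent_of_mem_support hs W v hD) (fun D hD => walk_r hs W v D hD a)
    (fun D hD => by rw [hrva]; exact hord D hD) hne
  have hneX : (polyPts s (W.st v).r a b c (deletePthPowers q (shear b c (W.b v b) (W.st v).F))).Nonempty := hsec.1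
  have hαX : alphaOf (polyPts s (W.st v).r a b c (deletePthPowers q (shear b c (W.b v b) (W.st v).F))) < 1 := by
    unfold alphaOf at hα ⊢; rw [hsec.2]; exact hα
  -- the pure α-law on `clean X`
  have hrb' : r' b = (W.st v).r b := by rw [hr'b, hrvb]
  have hra' : r' a + q = s + (W.st v).r a + (W.st v).r b := by rw [hr'a, hrva, hrvb]; omega
  have hlaw := betaOf_polyPts_alphaStep_le hab hac hbc hrb' hra' hrvc hr'c (W.b v a)⁻¹ 0
    (F := deletePthPowers q (shear b c (W.b v b) (W.st v).F))
    (fun D hD => by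
      rw [support_deletePthPowers', Finset.mem_filter] at hD
      exact le_trans (by omega) (hdegX D hD.1))
    (fun D hD => by
      obtain ⟨D₀, hD₀, hD₀a, -, -⟩ :=
        exists_dom_of_mem_support_shear (Ne.symm hac) (Ne.symm hbc) hab hLucas (W.b v b) (W.st v).F hD
      rw [support_deletePthPowers', Finset.mem_filter] at hD₀
      rw [← hD₀a]; exact walk_r hs W v D₀ hD₀.1 a)
    (fun D hD => by rw [support_deletePthPowers', Finset.mem_filter] at hD; exact hD.2) hneX hαX
  rw [alphaStep_deletePthPowers hab hac hbc hLucas, shear_zero] at hlaw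
  calc betaOf (polyPts s (W.st (v + 1)).r c b a (W.st (v + 1)).F)
      = betaOf (entryPts s (M + s) b a (deletePthPowers q (shear a c (W.b v a) (shear b c (W.b v b) (W.st v).F)))) := by rw [hT]
    _ = betaOf (entryPts s (M + s) b c (deletePthPowers q (shear c a (W.b v a)⁻¹ (shear b c (W.b v b) (W.st v).F)))) := by
          unfold betaOf; rw [hRI]
    _ = betaOf (polyPts s r' a b c (deletePthPowers q (chartTransform q a
          (shear c a (W.b v a)⁻¹ (shear b c (W.b v b) (W.st v).F))))) := by rw [hA]
    _ ≤ betaOf (polyPts s (W.st v).r a b c (deletePthPowers q (shear b c (W.b v b) (W.st v).F))) := hlaw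
    _ = betaOf (polyPts s (W.st v).r a b c (W.st v).F) := by unfold betaOf; rw [hsec.2]

end CeilingStepWalkGeneral

end Summit.ResolutionOfSingularities.ResolutionOfSingularities.Theorems.LossPolygon
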